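import Literature.MathematicalPhysics.QuantumFieldTheory.Balaban1983to89.B9Eq3117CurrentMajFromLetter
import Literature.MathematicalPhysics.QuantumFieldTheory.Balaban1983to89.Node00.OpsYSectDESymm
import Literature.MathematicalPhysics.QuantumFieldTheory.Balaban1983to89.B9Thm311AdjointPairs

/-!
# `Balaban1983to89.B9Eq3117NormClausesFromIdentity` — T. Bałaban, *Propagators for lattice gauge theories in a background field*, Commun. Math. Phys. **99**
# (1985) 389–434 [`Balaban1985BackgroundPropagators`, "B9"] (3.117) p. 419, (3.8) p. 392, (3.10) p. 392: THE TWO NORM-LOCAL (3.117) CLAUSES OF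
# `B9Eq3117CurrentMajFromLetter` (`hg` for `B = Δ(U)∘D_U`, `hdh` for `B† = D*_U∘Δ(U)`) FROM ONE EXACT IDENTITY LETTER — print's
# «`(Δ(U)D_Uλ)(b) = (i∕2)[J(b), λ(b₋) + R(U_b)λ(b₊)]`» at node00-def-Y's letters — the transposed clause through «D* is the adjoint of D» and «Δ is hermitian»

statement-level skeleton of published theorems with citation tags; proofs where landed; nothing here is a claim about the Yang–Mills mass gap

THE PRINT.  p. 419, (3.117): the Hessian (3.10) on a pure gauge mode is the commutator with the current, `(ΔD_Uλ)(b) = (i∕2)[J(b), λ(b₋) + R(U_b)λ(b₊)]`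
(the pub-balaban NE9 chain's `B9Eq3117HessOpGaugeMode.equiv_hessOp_covDerivL2K` on its carrier; r06's polarized form `B9Eq3117Polarized`); p. 392: (3.8) «D*
is the adjoint of D» and (3.10) «Δ … a hermitian operator» for the trace pairing — so `D*_U∘Δ(U) = (Δ(U)∘D_U)†` and the transposed stencil reads `A` on the
`2(d+1)` bonds at a site.

WHY THIS FILE (cell `pub-ymgap`, node N06; width seat `pub-ymgap-dag-n06-w8` (g4), CLAIM-13 2026-08-28).  `B9Eq3117CurrentMajFromLetter` (F17) +
`Summits/…/BalabanUVNodesN06CurrentMajAtPinsPhys` (F18) turn the two DISPLAYED norm clauses `hg ∕ hdh` (+ regularity at every fine bond) into the N06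
certificate's current letters `hBJ`.  node00-def-Y's (3.117) road (stone 1 = `Node00/OpsYCurlGrad`) will deliver the IDENTITY, not norm clauses.  THIS FILE is the
adapter, so that the certificate may display print's ONE identity:
* §1 ★ `hg_of_identity` (any complete normed algebra `𝔸`): from the identity letter
  `hId : ∀ Λ f, hessGradY i U Λ f = κ₃ • (JY i U f * M − M * JY i U f)`, `M = Λ(f₋) + R(U_f)Λ(f₊)` (sites charted by `boxEquiv`; the scalar `κ₃ : ℂ` DISPLAYED —
  print's `i∕2`), and transporters that are norm contractions with their inverses (`G ⊂ U(N)`): the clause `hg` with `k₃ = 2‖κ₃‖`.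
* `hg_of_identity_I` ∕ `hdh_of_identity_I` — the same at print's `κ₃ = i∕2` (node00-def-Y's coming `hessGradY_eq_comm_JY`): `k₃ = 1`, `N·1`.
* §2 ★★ `hdh_of_hg` (`𝔸 = M_N(ℂ)`, unitary-valued `U`): the transposed clause `hdh` with constant `N·k₃` from `hg` ALONE — `divHessY U` is the trace-pairing adjoint
  of `hessGradY U` (def-Y `hessY_isSymmTr` + dag-n06-j `isAdjTr_gradY_divY`), tested on `δ_x ⊗ F` (dag-n06-i's `trIP_deltaY_left ∕ right`,
  `abs_re_trace_conjTranspose_mul_le`, `opNorm_le_of_re_trace`: operator norm from trace pairings costs `N`); ★★ `hdh_of_identity` (§1 ∘ §2: `2N‖κ₃‖`).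
* §3 at def-Y's members (`trBasis N`, `SU(N)`-valued regular `U`): ★★ `hg_of_identity_reg335 ∕ hdh_of_identity_reg335` — the certificate-shaped clauses
  `h3117g ∕ h3117d` of F18 from ONE displayed identity binder `h3117 : ∀ x U, Reg335 → Reg336 → ∀ Λ f, hessGradY … = κ₃ • (…)` (unitarity from `mem_of_reg335`).
HONEST SCOPE.  Triangle inequalities and trace-pairing bookkeeping over landed definitions; (3.117) itself stays a DISPLAYED hypothesis (`hId`); nothing of [B9]'s
estimates asserted; count-neutral; N06 NOT discharged; one finite lattice at a time; nothing continuum ∕ OS ∕ mass gap ∕ Clay.  NEW file; declares nothing in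
`Node00.*`; nothing landed is modified.  0 `def`; net new unproved facts: 0.
-/

noncomputable section

namespace Literature.MathematicalPhysics.QuantumFieldTheory.Balaban1983to89.B9Eq3117NormClausesFromIdentity

open B6GlobalChartV1 (PV boxEquiv)
open B6KLevelCensusIndexV1 (KIdx)
open B9Eq39Adjoint (R)
open B9Thm311ReadingCoords (trIP IsAdjTr)
open B9Ineq349SiteAdjoint (trIP_deltaY_left trIP_deltaY_right abs_re_trace_conjTranspose_mul_le opNorm_le_of_re_trace)
open B9Thm311AdjointPairs (isAdjTr_gradY_divY)
open B9PerturbationSplitAtLetters (hessGradY divHessY)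
open B9PinMembersKLevelV1 (MemberY bg9Y reg335Y_iff)
open B9BackgroundsKLevelV1 (mem_of_reg335)
open B7Prop2SpecialUnitary (specialUnitaryUnits specialUnitaryUnits_le_unitaryUnits specialUnitaryUnits_le_U1)
open B10StarCount (shift_unshift unshift_shift)
open Node00 (SiteY FBondY CfgY JY deltaY hessY_isSymmTr isAdjTr_comp isAdjTr_of_isSymmTr)

variable {d ℓ : ℕ} {hd : 1 ≤ d + 1} {hL : Odd (ℓ + 1) ∧ 1 < ℓ + 1} {b₀ b₁ : ℝ}

/-! ## §1 The first clause from the identity -/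

section First

variable {𝔸 : Type} [NormedRing 𝔸] [NormedAlgebra ℂ 𝔸] [CompleteSpace 𝔸]
variable (i : KIdx d ℓ hd hL b₀ b₁)

/-- ★ **THE CLAUSE `hg` FROM THE IDENTITY (3.117)**: if `(Δ(U)D_Uλ)(f) = κ₃·(J(f)·M − M·J(f))` with `M = λ(f₋) + R(U_f)λ(f₊)` and the transporters are norm
contractions with their inverses, then `‖(Δ(U)D_Uλ)(f)‖ ≤ 2‖κ₃‖·‖J(f)‖·(‖λ(f₋)‖ + ‖λ(f₊)‖)`.
[cite: Balaban1985BackgroundPropagators, (3.117) p.419, (3.3) p.390, (3.35) p.396] -/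
theorem hg_of_identity {U : CfgY 𝔸 i} (hU1 : ∀ μ s, ‖(U μ s : 𝔸)‖ ≤ 1 ∧ ‖(((U μ s)⁻¹ : 𝔸ˣ) : 𝔸)‖ ≤ 1) {κ₃ : ℂ}
    (hId : ∀ (Λ : SiteY i → 𝔸) (f : FBondY i), hessGradY i U Λ f =
      κ₃ • (JY i U f * (Λ (boxEquiv i.hN f.src) + R (U f.dir f.src) (Λ (boxEquiv i.hN f.tgt))) -
        (Λ (boxEquiv i.hN f.src) + R (U f.dir f.src) (Λ (boxEquiv i.hN f.tgt))) * JY i U f))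
    (Λ : SiteY i → 𝔸) (f : FBondY i) :
    ‖hessGradY i U Λ f‖ ≤ 2 * ‖κ₃‖ * ‖JY i U f‖ * (‖Λ (boxEquiv i.hN f.src)‖ + ‖Λ (boxEquiv i.hN f.tgt)‖) := by
  rw [hId Λ f]
  set M : 𝔸 := Λ (boxEquiv i.hN f.src) + R (U f.dir f.src) (Λ (boxEquiv i.hN f.tgt)) with hM
  -- transport by a contraction with contracting inverse does not increase norms (the tree's `B16Txt357ThirdOrderNonAbelian.norm_R_le` pattern)
  have hR : ∀ (V : 𝔸ˣ) (X : 𝔸), ‖(V : 𝔸)‖ ≤ 1 ∧ ‖((V⁻¹ : 𝔸ˣ) : 𝔸)‖ ≤ 1 → ‖R V X‖ ≤ ‖X‖ := fun V X hV => by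
    unfold R
    calc ‖(V : 𝔸) * X * ((V⁻¹ : 𝔸ˣ) : 𝔸)‖ ≤ ‖(V : 𝔸) * X‖ * ‖((V⁻¹ : 𝔸ˣ) : 𝔸)‖ := norm_mul_le _ _
      _ ≤ (‖(V : 𝔸)‖ * ‖X‖) * ‖((V⁻¹ : 𝔸ˣ) : 𝔸)‖ := mul_le_mul_of_nonneg_right (norm_mul_le _ _) (norm_nonneg _)
      _ ≤ (1 * ‖X‖) * 1 := mul_le_mul (mul_le_mul_of_nonneg_right hV.1 (norm_nonneg _)) hV.2 (norm_nonneg _) (by positivity)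
      _ = ‖X‖ := by ring
  have hMle : ‖M‖ ≤ ‖Λ (boxEquiv i.hN f.src)‖ + ‖Λ (boxEquiv i.hN f.tgt)‖ :=
    (norm_add_le _ _).trans (add_le_add le_rfl (hR _ _ (hU1 _ _)))
  calc ‖κ₃ • (JY i U f * M - M * JY i U f)‖ = ‖κ₃‖ * ‖JY i U f * M - M * JY i U f‖ := norm_smul _ _
    _ ≤ ‖κ₃‖ * (‖JY i U f‖ * ‖M‖ + ‖M‖ * ‖JY i U f‖) :=
        mul_le_mul_of_nonneg_left ((norm_sub_le _ _).trans (add_le_add (norm_mul_le _ _) (norm_mul_le _ _))) (norm_nonneg _)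
    _ = 2 * ‖κ₃‖ * ‖JY i U f‖ * ‖M‖ := by ring
    _ ≤ 2 * ‖κ₃‖ * ‖JY i U f‖ * (‖Λ (boxEquiv i.hN f.src)‖ + ‖Λ (boxEquiv i.hN f.tgt)‖) :=
        mul_le_mul_of_nonneg_left hMle (by positivity)

/-- ★ **THE CLAUSE `hg` WITH `k₃ = 1` FROM PRINT's IDENTITY** (`κ₃ = i∕2`, node00-def-Y's `hessGradY_eq_comm_JY` shape):
`‖(Δ(U)D_Uλ)(f)‖ ≤ ‖J(f)‖·(‖λ(f₋)‖ + ‖λ(f₊)‖)`. [cite: Balaban1985BackgroundPropagators, (3.117) p.419, (3.35) p.396] -/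
theorem hg_of_identity_I {U : CfgY 𝔸 i} (hU1 : ∀ μ s, ‖(U μ s : 𝔸)‖ ≤ 1 ∧ ‖(((U μ s)⁻¹ : 𝔸ˣ) : 𝔸)‖ ≤ 1)
    (hId : ∀ (Λ : SiteY i → 𝔸) (f : FBondY i), hessGradY i U Λ f =
      (Complex.I / 2) • (JY i U f * (Λ (boxEquiv i.hN f.src) + R (U f.dir f.src) (Λ (boxEquiv i.hN f.tgt))) -
        (Λ (boxEquiv i.hN f.src) + R (U f.dir f.src) (Λ (boxEquiv i.hN f.tgt))) * JY i U f))
    (Λ : SiteY i → 𝔸) (f : FBondY i) :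
    ‖hessGradY i U Λ f‖ ≤ 1 * ‖JY i U f‖ * (‖Λ (boxEquiv i.hN f.src)‖ + ‖Λ (boxEquiv i.hN f.tgt)‖) := by
  have h := hg_of_identity i hU1 hId Λ f
  have hI : ‖(Complex.I / 2 : ℂ)‖ = 1 / 2 := by rw [norm_div, Complex.norm_I]; norm_num
  rw [hI] at h
  norm_num at h ⊢
  exact h

end First

/-! ## §2 The transposed clause from the first one: `D*_U∘Δ(U) = (Δ(U)∘D_U)†`, tested on `δ_x ⊗ F` -/

section Transpose

open scoped Matrix Matrix.Norms.L2Operator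

variable (i : KIdx d ℓ hd hL b₀ b₁) {N : ℕ}

/-- ★★ **THE TRANSPOSED CLAUSE `hdh` FROM `hg` ALONE** (`𝔸 = M_N(ℂ)`, unitary-valued `U`): `divHessY U = D*_U∘Δ(U)` is the adjoint of `hessGradY U = Δ(U)∘D_U` for the
trace pairing ((3.8) + (3.10)); testing `⟨D*ΔA, δ_x⊗F⟩ = ⟨A, ΔD(δ_x⊗F)⟩` against the one-step stencil `hg` and reading the operator norm from the pairings gives
`‖(D*_UΔ(U)A)(x)‖ ≤ N·k₃·Σ_μ (‖J⟨x,μ⟩‖·‖A⟨x,μ⟩‖ + ‖J⟨x−e_μ,μ⟩‖·‖A⟨x−e_μ,μ⟩‖)`.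
[cite: Balaban1985BackgroundPropagators, (3.117) p.419, (3.8) p.392, (3.10) p.392, p.421] -/
theorem hdh_of_hg (U : CfgY (Matrix (Fin N) (Fin N) ℂ) i)
    (hU : ∀ μ x, ((U μ x : (Matrix (Fin N) (Fin N) ℂ)ˣ) : Matrix (Fin N) (Fin N) ℂ) ∈ unitary (Matrix (Fin N) (Fin N) ℂ))
    {k₃ : ℝ} (hk₃ : 0 ≤ k₃)
    (hg : ∀ (Λ : SiteY i → Matrix (Fin N) (Fin N) ℂ) (f : FBondY i),
      ‖hessGradY i U Λ f‖ ≤ k₃ * ‖JY i U f‖ * (‖Λ (boxEquiv i.hN f.src)‖ + ‖Λ (boxEquiv i.hN f.tgt)‖))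
    (A : FBondY i → Matrix (Fin N) (Fin N) ℂ) (s : Site (PV d ℓ i.m i.K hd hL) 0) :
    ‖divHessY i U A (boxEquiv i.hN s)‖ ≤ N * k₃ * ∑ μ : Fin (d + 1),
      (‖JY i U ⟨s, μ⟩‖ * ‖A ⟨s, μ⟩‖ + ‖JY i U ⟨s.unshift μ, μ⟩‖ * ‖A ⟨s.unshift μ, μ⟩‖) := by
  classical
  have hadj : IsAdjTr (fun _ => (1 : ℝ)) (fun _ => (1 : ℝ)) (hessGradY i U) (divHessY i U) := by
    unfold hessGradY divHessY
    exact isAdjTr_comp (isAdjTr_of_isSymmTr (hessY_isSymmTr i U hU)) (isAdjTr_gradY_divY i U hU)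
  set S : ℝ := ∑ μ : Fin (d + 1), (‖JY i U ⟨s, μ⟩‖ * ‖A ⟨s, μ⟩‖ + ‖JY i U ⟨s.unshift μ, μ⟩‖ * ‖A ⟨s.unshift μ, μ⟩‖) with hS
  have hS0 : 0 ≤ S := Finset.sum_nonneg fun μ _ => by positivity
  refine opNorm_le_of_re_trace _ (by positivity) fun F hF => ?_
  -- ⟨δ⊗F, D*ΔA⟩ = ⟨ΔD(δ⊗F), A⟩
  have hpair : (Matrix.trace (Fᴴ * divHessY i U A (boxEquiv i.hN s))).re =
      trIP (fun _ => (1 : ℝ)) (hessGradY i U (deltaY (boxEquiv i.hN s) F)) A := by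
    have h := hadj (deltaY (boxEquiv i.hN s) F) A
    rw [trIP_deltaY_left, one_mul] at h
    exact h.symm
  rw [hpair, B9Thm311ReadingCoords.trIP_eq_re_trace]
  -- bond by bond: |Re tr((ΔDδ⊗F)(f)ᴴ A(f))| ≤ N‖(ΔDδ⊗F)(f)‖‖A f‖ ≤ N k₃ ‖J f‖ (𝟙[f₋ = x] + 𝟙[f₊ = x]) ‖A f‖
  have hδ : ∀ z : SiteY i, ‖deltaY (boxEquiv i.hN s) F z‖ ≤ (if z = boxEquiv i.hN s then 1 else 0 : ℝ) := fun z => by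
    unfold deltaY
    split_ifs <;> first | exact hF | (exfalso; contradiction) | simp
  have hterm : ∀ f : FBondY i, 1 * (Matrix.trace ((hessGradY i U (deltaY (boxEquiv i.hN s) F) f)ᴴ * A f)).re ≤
      N * k₃ * (‖JY i U f‖ * ‖A f‖ * ((if boxEquiv i.hN f.src = boxEquiv i.hN s then 1 else 0 : ℝ) +
        (if boxEquiv i.hN f.tgt = boxEquiv i.hN s then 1 else 0 : ℝ))) := fun f => by
    rw [one_mul]
    refine (le_abs_self _).trans ((abs_re_trace_conjTranspose_mul_le _ _).trans ?_)
    have h1 := (hg (deltaY (boxEquiv i.hN s) F) f).trans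
      (mul_le_mul_of_nonneg_left (add_le_add (hδ _) (hδ _)) (mul_nonneg hk₃ (norm_nonneg _)))
    have hA : 0 ≤ ‖A f‖ := norm_nonneg _
    calc (N : ℝ) * ‖hessGradY i U (deltaY (boxEquiv i.hN s) F) f‖ * ‖A f‖
        ≤ N * (k₃ * ‖JY i U f‖ * ((if boxEquiv i.hN f.src = boxEquiv i.hN s then 1 else 0 : ℝ) +
            (if boxEquiv i.hN f.tgt = boxEquiv i.hN s then 1 else 0 : ℝ))) * ‖A f‖ :=
          mul_le_mul_of_nonneg_right (mul_le_mul_of_nonneg_left h1 (Nat.cast_nonneg N)) hA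
      _ = _ := by ring
  refine (Finset.sum_le_sum fun f _ => hterm f).trans ?_
  rw [← Finset.mul_sum]
  refine mul_le_mul_of_nonneg_left ?_ (by positivity)
  -- the indicator sums are the 2(d+1) bonds at x
  have hsrc : ∀ f : FBondY i, (boxEquiv i.hN f.src = boxEquiv i.hN s) ↔ f.src = s := fun f => (boxEquiv i.hN).injective.eq_iff
  have htgt : ∀ f : FBondY i, (boxEquiv i.hN f.tgt = boxEquiv i.hN s) ↔ f.src = s.unshift f.dir := fun f => by
    rw [(boxEquiv i.hN).injective.eq_iff]
    constructor
    · intro h; rw [← h]; exact (unshift_shift f.src f.dir).symm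
    · intro h; rw [PBond.tgt, h]; exact shift_unshift s f.dir
  -- rewrite the sum over bonds as a sum over (src, dir)
  have hsum : ∑ f : FBondY i, ‖JY i U f‖ * ‖A f‖ * ((if boxEquiv i.hN f.src = boxEquiv i.hN s then 1 else 0 : ℝ) +
        (if boxEquiv i.hN f.tgt = boxEquiv i.hN s then 1 else 0 : ℝ)) =
      ∑ f : FBondY i, (‖JY i U f‖ * ‖A f‖ * (if f.src = s then 1 else 0 : ℝ) +
        ‖JY i U f‖ * ‖A f‖ * (if f.src = s.unshift f.dir then 1 else 0 : ℝ)) :=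
    Finset.sum_congr rfl fun f _ => by
      simp only [hsrc f, htgt f]; ring
  rw [hsum, Finset.sum_add_distrib]
  -- each indicator sum is a sum over directions
  have e : (Finset.univ : Finset (FBondY i)) = Finset.univ.image (fun p : Site (PV d ℓ i.m i.K hd hL) 0 × Fin (d + 1) => (⟨p.1, p.2⟩ : FBondY i)) := by
    ext f; simp only [Finset.mem_univ, Finset.mem_image, true_and, true_iff]; exact ⟨(f.src, f.dir), rfl⟩
  have hinj : Function.Injective (fun p : Site (PV d ℓ i.m i.K hd hL) 0 × Fin (d + 1) => (⟨p.1, p.2⟩ : FBondY i)) := by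
    intro p q h; cases p; cases q; simp only [PBond.mk.injEq] at h; exact Prod.ext h.1 h.2
  have h1 : ∑ f : FBondY i, ‖JY i U f‖ * ‖A f‖ * (if f.src = s then 1 else 0 : ℝ) = ∑ μ : Fin (d + 1), ‖JY i U ⟨s, μ⟩‖ * ‖A ⟨s, μ⟩‖ := by
    rw [e, Finset.sum_image fun p _ q _ h => hinj h, ← Finset.univ_product_univ, Finset.sum_product, Finset.sum_eq_single s]
    · exact Finset.sum_congr rfl fun μ _ => by simp
    · intro t _ hts; exact Finset.sum_eq_zero fun μ _ => by simp [hts]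
    · intro h; exact absurd (Finset.mem_univ s) h
  have h2 : ∑ f : FBondY i, ‖JY i U f‖ * ‖A f‖ * (if f.src = s.unshift f.dir then 1 else 0 : ℝ) =
      ∑ μ : Fin (d + 1), ‖JY i U ⟨s.unshift μ, μ⟩‖ * ‖A ⟨s.unshift μ, μ⟩‖ := by
    rw [e, Finset.sum_image fun p _ q _ h => hinj h, ← Finset.univ_product_univ, Finset.sum_product, Finset.sum_comm]
    refine Finset.sum_congr rfl fun μ _ => ?_
    rw [Finset.sum_eq_single (s.unshift μ)]
    · simp
    · intro t _ ht; simp [ht]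
    · intro h; exact absurd (Finset.mem_univ _) h
  rw [h1, h2, ← Finset.sum_add_distrib]

/-- ★★ **THE TRANSPOSED CLAUSE FROM THE IDENTITY (3.117)** (§1 ∘ §2): constant `2N‖κ₃‖`.
[cite: Balaban1985BackgroundPropagators, (3.117) p.419, (3.8) p.392, (3.10) p.392, p.421] -/
theorem hdh_of_identity (U : CfgY (Matrix (Fin N) (Fin N) ℂ) i)
    (hU : ∀ μ x, ((U μ x : (Matrix (Fin N) (Fin N) ℂ)ˣ) : Matrix (Fin N) (Fin N) ℂ) ∈ unitary (Matrix (Fin N) (Fin N) ℂ))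
    (hU1 : ∀ μ s, ‖((U μ s : (Matrix (Fin N) (Fin N) ℂ)ˣ) : Matrix (Fin N) (Fin N) ℂ)‖ ≤ 1 ∧
      ‖(((U μ s)⁻¹ : (Matrix (Fin N) (Fin N) ℂ)ˣ) : Matrix (Fin N) (Fin N) ℂ)‖ ≤ 1) {κ₃ : ℂ}
    (hId : ∀ (Λ : SiteY i → Matrix (Fin N) (Fin N) ℂ) (f : FBondY i), hessGradY i U Λ f =
      κ₃ • (JY i U f * (Λ (boxEquiv i.hN f.src) + R (U f.dir f.src) (Λ (boxEquiv i.hN f.tgt))) -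
        (Λ (boxEquiv i.hN f.src) + R (U f.dir f.src) (Λ (boxEquiv i.hN f.tgt))) * JY i U f))
    (A : FBondY i → Matrix (Fin N) (Fin N) ℂ) (s : Site (PV d ℓ i.m i.K hd hL) 0) :
    ‖divHessY i U A (boxEquiv i.hN s)‖ ≤ N * (2 * ‖κ₃‖) * ∑ μ : Fin (d + 1),
      (‖JY i U ⟨s, μ⟩‖ * ‖A ⟨s, μ⟩‖ + ‖JY i U ⟨s.unshift μ, μ⟩‖ * ‖A ⟨s.unshift μ, μ⟩‖) :=
  hdh_of_hg i U hU (by positivity) (hg_of_identity i hU1 hId) A s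

/-- ★★ **THE TRANSPOSED CLAUSE WITH `k₃ = N` FROM PRINT's IDENTITY** (`κ₃ = i∕2`). [cite: Balaban1985BackgroundPropagators, (3.117) p.419, (3.8) p.392, (3.10) p.392] -/
theorem hdh_of_identity_I (U : CfgY (Matrix (Fin N) (Fin N) ℂ) i)
    (hU : ∀ μ x, ((U μ x : (Matrix (Fin N) (Fin N) ℂ)ˣ) : Matrix (Fin N) (Fin N) ℂ) ∈ unitary (Matrix (Fin N) (Fin N) ℂ))
    (hU1 : ∀ μ s, ‖((U μ s : (Matrix (Fin N) (Fin N) ℂ)ˣ) : Matrix (Fin N) (Fin N) ℂ)‖ ≤ 1 ∧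
      ‖(((U μ s)⁻¹ : (Matrix (Fin N) (Fin N) ℂ)ˣ) : Matrix (Fin N) (Fin N) ℂ)‖ ≤ 1)
    (hId : ∀ (Λ : SiteY i → Matrix (Fin N) (Fin N) ℂ) (f : FBondY i), hessGradY i U Λ f =
      (Complex.I / 2) • (JY i U f * (Λ (boxEquiv i.hN f.src) + R (U f.dir f.src) (Λ (boxEquiv i.hN f.tgt))) -
        (Λ (boxEquiv i.hN f.src) + R (U f.dir f.src) (Λ (boxEquiv i.hN f.tgt))) * JY i U f))
    (A : FBondY i → Matrix (Fin N) (Fin N) ℂ) (s : Site (PV d ℓ i.m i.K hd hL) 0) :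
    ‖divHessY i U A (boxEquiv i.hN s)‖ ≤ N * 1 * ∑ μ : Fin (d + 1),
      (‖JY i U ⟨s, μ⟩‖ * ‖A ⟨s, μ⟩‖ + ‖JY i U ⟨s.unshift μ, μ⟩‖ * ‖A ⟨s.unshift μ, μ⟩‖) :=
  hdh_of_hg i U hU zero_le_one (hg_of_identity_I i hU1 hId) A s

end Transpose

/-! ## §3 At node00-def-Y's members: the certificate-shaped clauses `h3117g ∕ h3117d` from ONE displayed identity binder -/

section Members

open scoped Matrix Matrix.Norms.L2Operator

variable {Mstar : ℕ} {N : ℕ} [NeZero N]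

/-- at a member, a (3.35)-regular configuration is `SU(N)`-valued: unitary, and a norm contraction with its inverse.
[cite: Balaban1985BackgroundPropagators, (3.35) p.396 («U has values in G»)] -/
theorem unitary_of_reg335 (x : MemberY d ℓ hd hL b₀ b₁ Mstar) {c α₀ : ℝ}
    {U : (bg9Y (Matrix (Fin N) (Fin N) ℂ) (specialUnitaryUnits (Fin N)) x).Cfg}
    (hU : (bg9Y (Matrix (Fin N) (Fin N) ℂ) (specialUnitaryUnits (Fin N)) x).Reg335 c α₀ U) (μ : Fin (d + 1)) (s : Site (PV d ℓ x.toKIdx.m x.toKIdx.K hd hL) 0) :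
    ((U μ s : (Matrix (Fin N) (Fin N) ℂ)ˣ) : Matrix (Fin N) (Fin N) ℂ) ∈ unitary (Matrix (Fin N) (Fin N) ℂ) ∧
      (‖((U μ s : (Matrix (Fin N) (Fin N) ℂ)ˣ) : Matrix (Fin N) (Fin N) ℂ)‖ ≤ 1 ∧
        ‖(((U μ s)⁻¹ : (Matrix (Fin N) (Fin N) ℂ)ˣ) : Matrix (Fin N) (Fin N) ℂ)‖ ≤ 1) := by
  have hG : U μ s ∈ specialUnitaryUnits (Fin N) := mem_of_reg335 x.toKIdx ((reg335Y_iff x c α₀ U).1 hU).1 μ s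
  exact ⟨specialUnitaryUnits_le_unitaryUnits hG, specialUnitaryUnits_le_U1 hG⟩

/-- ★★ **`h3117g` AT THE PINS FROM THE IDENTITY BINDER**: for a member `x` and a (3.35)-regular `U` (any class constant `c`), the displayed identity
`∀ Λ f, hessGradY x.toKIdx U Λ f = κ₃ • (JY … f * M − M * JY … f)` gives F18's clause `h3117g` with `k₃ = 2‖κ₃‖`.
[cite: Balaban1985BackgroundPropagators, (3.117) p.419, (3.35) p.396] -/
theorem hg_of_identity_reg335 (x : MemberY d ℓ hd hL b₀ b₁ Mstar) {c α₀ : ℝ}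
    {U : (bg9Y (Matrix (Fin N) (Fin N) ℂ) (specialUnitaryUnits (Fin N)) x).Cfg}
    (hU : (bg9Y (Matrix (Fin N) (Fin N) ℂ) (specialUnitaryUnits (Fin N)) x).Reg335 c α₀ U) {κ₃ : ℂ}
    (hId : ∀ (Λ : SiteY x.toKIdx → Matrix (Fin N) (Fin N) ℂ) (f : FBondY x.toKIdx), hessGradY x.toKIdx U Λ f =
      κ₃ • (JY x.toKIdx U f * (Λ (boxEquiv x.hN f.src) + R (U f.dir f.src) (Λ (boxEquiv x.hN f.tgt))) -
        (Λ (boxEquiv x.hN f.src) + R (U f.dir f.src) (Λ (boxEquiv x.hN f.tgt))) * JY x.toKIdx U f))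
    (Λ : SiteY x.toKIdx → Matrix (Fin N) (Fin N) ℂ) (f : FBondY x.toKIdx) :
    ‖hessGradY x.toKIdx U Λ f‖ ≤ 2 * ‖κ₃‖ * ‖JY x.toKIdx U f‖ * (‖Λ (boxEquiv x.hN f.src)‖ + ‖Λ (boxEquiv x.hN f.tgt)‖) :=
  hg_of_identity x.toKIdx (fun μ s => (unitary_of_reg335 x hU μ s).2) hId Λ f

/-- ★★ **`h3117d` AT THE PINS FROM THE IDENTITY BINDER**: same hypotheses; F18's transposed clause with `k₃ = N·(2‖κ₃‖)`.
[cite: Balaban1985BackgroundPropagators, (3.117) p.419, (3.8) p.392, (3.10) p.392, (3.35) p.396] -/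
theorem hdh_of_identity_reg335 (x : MemberY d ℓ hd hL b₀ b₁ Mstar) {c α₀ : ℝ}
    {U : (bg9Y (Matrix (Fin N) (Fin N) ℂ) (specialUnitaryUnits (Fin N)) x).Cfg}
    (hU : (bg9Y (Matrix (Fin N) (Fin N) ℂ) (specialUnitaryUnits (Fin N)) x).Reg335 c α₀ U) {κ₃ : ℂ}
    (hId : ∀ (Λ : SiteY x.toKIdx → Matrix (Fin N) (Fin N) ℂ) (f : FBondY x.toKIdx), hessGradY x.toKIdx U Λ f =
      κ₃ • (JY x.toKIdx U f * (Λ (boxEquiv x.hN f.src) + R (U f.dir f.src) (Λ (boxEquiv x.hN f.tgt))) -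
        (Λ (boxEquiv x.hN f.src) + R (U f.dir f.src) (Λ (boxEquiv x.hN f.tgt))) * JY x.toKIdx U f))
    (A : FBondY x.toKIdx → Matrix (Fin N) (Fin N) ℂ) (s : Site (PV d ℓ x.toKIdx.m x.toKIdx.K hd hL) 0) :
    ‖divHessY x.toKIdx U A (boxEquiv x.hN s)‖ ≤ N * (2 * ‖κ₃‖) * ∑ μ : Fin (d + 1),
      (‖JY x.toKIdx U ⟨s, μ⟩‖ * ‖A ⟨s, μ⟩‖ + ‖JY x.toKIdx U ⟨s.unshift μ, μ⟩‖ * ‖A ⟨s.unshift μ, μ⟩‖) :=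
  hdh_of_identity x.toKIdx U (fun μ z => (unitary_of_reg335 x hU μ z).1) (fun μ z => (unitary_of_reg335 x hU μ z).2) hId A s

end Members

end Literature.MathematicalPhysics.QuantumFieldTheory.Balaban1983to89.B9Eq3117NormClausesFromIdentity

end
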